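import Summits.AtomisticToContinuum.Crystallization.Theses.BraggSlacknessRigidity
import Summits.AtomisticToContinuum.Crystallization.Theorems.ThreeConeCertificateExactCertificatePeriodicMinimum

/-!
# Crux `StrictCertificate` (stmt-AtomisticToContinuum-13167, route `BraggSlacknessRigidity`), line
# `registered`: reductions for the stub `stub_hcpPeriodicMinimum`

Support file — nothing here closes an item, and the stub itself is NOT proved here.  The line's
skeleton isolates

`stub_hcpPeriodicMinimum : ∃ a h (ha : a ≠ 0) (hh : h ≠ 0), ∀ Q, e_LJ(hcp ha hh) ≤ e_LJ(Q)`,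

i.e. SOME hexagonal close packing `hcpPeriodicConfiguration ha hh` (both parameters relaxed)
minimises the Lennard-Jones energy per particle among ALL periodic configurations of `ℝ³`.  This is
the open problem "the Lennard-Jones periodic ground state of `ℝ³` is (relaxed) hcp" (Blanc–Lewin 2015,
§2.3).  We certify, kernel-checked, where it sits between EXISTING open items of the summit:

* `stub_hcpPeriodicMinimum_of_hcpPeriodicMinimiser` — item stmt-AtomisticToContinuum-3061
  `HcpPeriodicMinimiser` (hcp with `(a,h)` in the box `B`, phrased with `IsLeast`) **implies the stub**
  (drop the box, unpack `IsLeast`);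
* `crysPeriodicMinAttained_of_stub_hcpPeriodicMinimum` — **the stub implies** item
  stmt-AtomisticToContinuum-0627 `crys_periodic_min_attained` (`∃ P, IsLeast (range e_LJ) (e_LJ P)`, the
  attained-minimum half of conjunct (i) of the summit), with `P := hcp ha hh`;
* `periodicMinimum_of_stub_hcpPeriodicMinimum`, `keplerBound_of_stub_hcpPeriodicMinimum`,
  `hasPeriodicGroundStateEnergy_of_stub_hcpPeriodicMinimum` — hence the anonymous periodic minimum
  (stub `stub_periodicMinimum` of the sibling crux 11959), the route's `KeplerBound` (item 11961; the two
  route-local `KeplerBound` definitions of `ThreeConeCertificate` and `BraggSlacknessRigidity` have the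
  same body) and conjunct (i) `HasPeriodicGroundStateEnergy lennardJones 3`, through the landed
  equivalences of `Theorems/ThreeConeCertificateExactCertificatePeriodicMinimum.lean`;
* `stub_hcpPeriodicMinimum_iff_exists_isLeast`, `stub_hcpPeriodicMinimum_iff_exists_eq_eStar` — order
  bookkeeping: the stub says some `e_LJ(hcp ha hh)` is a least element of the range, equivalently equals
  the periodic infimum `e* = ChargedEnergyGapNegative.eStar`.

So the stub is open exactly as item 3061 is open (it is 3061 without the box constraint on `(a,h)`) and
at least as hard as item 0627; no proof and no disproof is claimed here.
-/

noncomputable section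

namespace Summit.AtomisticToContinuum.Crystallization.Theorems.BraggSlacknessRigidityStrictCertificate

open Literature.MathematicalPhysics.StatisticalMechanics
open Summit.AtomisticToContinuum.Crystallization.Theses.BraggSlacknessRigidity (KeplerBound)
open Summit.AtomisticToContinuum.Crystallization.Theorems.ChargedEnergyGapNegative (eStar eStar_le)
open Summit.AtomisticToContinuum.Crystallization.Theorems.ThreeConeCertificateExactCertificate
  (periodicMinimum_iff_exists_isLeast keplerBound_of_periodicMinimum
    stub_periodicMinimum_iff_hasPeriodicGroundStateEnergy)

/-- **Item 3061 `HcpPeriodicMinimiser` implies the stub `stub_hcpPeriodicMinimum`**: forget the box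
`47/50 ≤ a ≤ 1`, `39/50·a ≤ h ≤ 17/20·a` and read the lower-bound half of `IsLeast` at `⟨Q, rfl⟩`.
[folklore] -/
theorem stub_hcpPeriodicMinimum_of_hcpPeriodicMinimiser : (∃ a h : ℝ, ∃ (ha : a ≠ 0) (hh : h ≠ 0), 47 / 50 ≤ a ∧ a ≤ 1 ∧ 39 / 50 * a ≤ h ∧ h ≤ 17 / 20 * a ∧ IsLeast (Set.range fun Q : Literature.MathematicalPhysics.StatisticalMechanics.PeriodicConfiguration 3 => Q.energyPerParticle Literature.MathematicalPhysics.StatisticalMechanics.lennardJones) ((Literature.MathematicalPhysics.StatisticalMechanics.hcpPeriodicConfiguration ha hh).energyPerParticle Literature.MathematicalPhysics.StatisticalMechanics.lennardJones)) → ∃ (a h : ℝ) (ha : a ≠ 0) (hh : h ≠ 0), ∀ Q : Literature.MathematicalPhysics.StatisticalMechanics.PeriodicConfiguration 3, (Literature.MathematicalPhysics.StatisticalMechanics.hcpPeriodicConfiguration ha hh).energyPerParticle Literature.MathematicalPhysics.StatisticalMechanics.lennardJones ≤ Q.energyPerParticle Literature.MathematicalPhysics.StatisticalMechanics.lennardJones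 := by
  rintro ⟨a, h, ha, hh, -, -, -, -, hleast⟩
  exact ⟨a, h, ha, hh, fun Q => hleast.2 ⟨Q, rfl⟩⟩

/-- **The stub `stub_hcpPeriodicMinimum` implies item 0627 `crys_periodic_min_attained`**: the minimising
`P := hcpPeriodicConfiguration ha hh` is a periodic configuration whose energy per particle is a least
element of the range (`⟨⟨P, rfl⟩, lower bound⟩`). [folklore] -/
theorem crysPeriodicMinAttained_of_stub_hcpPeriodicMinimum :
    (∃ (a h : ℝ) (ha : a ≠ 0) (hh : h ≠ 0), ∀ Q : Literature.MathematicalPhysics.StatisticalMechanics.PeriodicConfiguration 3, (Literature.MathematicalPhysics.StatisticalMechanics.hcpPeriodicConfiguration ha hh).energyPerParticle Literature.MathematicalPhysics.StatisticalMechanics.lennardJones ≤ Q.energyPerParticle Literature.MathematicalPhysics.StatisticalMechanics.lennardJones) →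
      ∃ P : Literature.MathematicalPhysics.StatisticalMechanics.PeriodicConfiguration 3, IsLeast (Set.range fun Q : Literature.MathematicalPhysics.StatisticalMechanics.PeriodicConfiguration 3 => Q.energyPerParticle Literature.MathematicalPhysics.StatisticalMechanics.lennardJones) (P.energyPerParticle Literature.MathematicalPhysics.StatisticalMechanics.lennardJones) := by
  rintro ⟨a, h, ha, hh, hmin⟩
  refine ⟨hcpPeriodicConfiguration ha hh, ⟨hcpPeriodicConfiguration ha hh, rfl⟩, ?_⟩
  rintro _ ⟨Q, rfl⟩
  exact hmin Q

/-- **The stub implies the anonymous periodic minimum** `∃ P, ∀ Q, e_LJ(P) ≤ e_LJ(Q)` (stub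
`stub_periodicMinimum` of the sibling crux `ExactCertificate`, 11959): it names the minimiser's family,
so it is at least as strong. [folklore] -/
theorem periodicMinimum_of_stub_hcpPeriodicMinimum :
    (∃ (a h : ℝ) (ha : a ≠ 0) (hh : h ≠ 0), ∀ Q : Literature.MathematicalPhysics.StatisticalMechanics.PeriodicConfiguration 3, (Literature.MathematicalPhysics.StatisticalMechanics.hcpPeriodicConfiguration ha hh).energyPerParticle Literature.MathematicalPhysics.StatisticalMechanics.lennardJones ≤ Q.energyPerParticle Literature.MathematicalPhysics.StatisticalMechanics.lennardJones) →
      ∃ P : Literature.MathematicalPhysics.StatisticalMechanics.PeriodicConfiguration 3, ∀ Q : Literature.MathematicalPhysics.StatisticalMechanics.PeriodicConfiguration 3, P.energyPerParticle Literature.MathematicalPhysics.StatisticalMechanics.lennardJones ≤ Q.energyPerParticle Literature.MathematicalPhysics.StatisticalMechanics.lennardJones := by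
  rintro ⟨a, h, ha, hh, hmin⟩
  exact ⟨hcpPeriodicConfiguration ha hh, hmin⟩

/-- **The stub implies the route's `KeplerBound`** (item stmt-AtomisticToContinuum-11961,
`∃ P, ∀ N x injective, N · e_LJ(P) ≤ E_LJ(x)`): through the anonymous periodic minimum and the landed
`keplerBound_of_periodicMinimum` (periodisation `N · e* ≤ E_LJ(x)`); the `KeplerBound` of route
`BraggSlacknessRigidity` and that of route `ThreeConeCertificate` have the same body. [folklore] -/
theorem keplerBound_of_stub_hcpPeriodicMinimum :
    (∃ (a h : ℝ) (ha : a ≠ 0) (hh : h ≠ 0), ∀ Q : Literature.MathematicalPhysics.StatisticalMechanics.PeriodicConfiguration 3, (Literature.MathematicalPhysics.StatisticalMechanics.hcpPeriodicConfiguration ha hh).energyPerParticle Literature.MathematicalPhysics.StatisticalMechanics.lennardJones ≤ Q.energyPerParticle Literature.MathematicalPhysics.StatisticalMechanics.lennardJones) →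
      KeplerBound := fun hstub =>
  keplerBound_of_periodicMinimum (periodicMinimum_of_stub_hcpPeriodicMinimum hstub)

/-- **The stub implies conjunct (i) of the summit's sub-problem `Crystallization`**,
`HasPeriodicGroundStateEnergy lennardJones 3` (thermodynamic limit `E(N)/N → e*` attained by a periodic
configuration), through the landed `stub_periodicMinimum_iff_hasPeriodicGroundStateEnergy`. [folklore] -/
theorem hasPeriodicGroundStateEnergy_of_stub_hcpPeriodicMinimum :
    (∃ (a h : ℝ) (ha : a ≠ 0) (hh : h ≠ 0), ∀ Q : Literature.MathematicalPhysics.StatisticalMechanics.PeriodicConfiguration 3, (Literature.MathematicalPhysics.StatisticalMechanics.hcpPeriodicConfiguration ha hh).energyPerParticle Literature.MathematicalPhysics.StatisticalMechanics.lennardJones ≤ Q.energyPerParticle Literature.MathematicalPhysics.StatisticalMechanics.lennardJones) →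
      Literature.MathematicalPhysics.StatisticalMechanics.HasPeriodicGroundStateEnergy Literature.MathematicalPhysics.StatisticalMechanics.lennardJones 3 := fun hstub =>
  stub_periodicMinimum_iff_hasPeriodicGroundStateEnergy.1 (periodicMinimum_of_stub_hcpPeriodicMinimum hstub)

/-- **Order bookkeeping: the stub says some `e_LJ(hcp ha hh)` is a least element of the range** of the
energy per particle over periodic configurations (i.e. it is item 3061 with the box on `(a,h)` dropped).
[folklore] -/
theorem stub_hcpPeriodicMinimum_iff_exists_isLeast :
    (∃ (a h : ℝ) (ha : a ≠ 0) (hh : h ≠ 0), ∀ Q : Literature.MathematicalPhysics.StatisticalMechanics.PeriodicConfiguration 3, (Literature.MathematicalPhysics.StatisticalMechanics.hcpPeriodicConfiguration ha hh).energyPerParticle Literature.MathematicalPhysics.StatisticalMechanics.lennardJones ≤ Q.energyPerParticle Literature.MathematicalPhysics.StatisticalMechanics.lennardJones) ↔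
      ∃ (a h : ℝ) (ha : a ≠ 0) (hh : h ≠ 0), IsLeast (Set.range fun Q : Literature.MathematicalPhysics.StatisticalMechanics.PeriodicConfiguration 3 => Q.energyPerParticle Literature.MathematicalPhysics.StatisticalMechanics.lennardJones) ((Literature.MathematicalPhysics.StatisticalMechanics.hcpPeriodicConfiguration ha hh).energyPerParticle Literature.MathematicalPhysics.StatisticalMechanics.lennardJones) := by
  refine exists_congr fun a => exists_congr fun h => exists_congr fun ha => exists_congr fun hh => ?_
  refine ⟨fun hmin => ⟨⟨hcpPeriodicConfiguration ha hh, rfl⟩, ?_⟩, fun hl Q => hl.2 ⟨Q, rfl⟩⟩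
  rintro _ ⟨Q, rfl⟩
  exact hmin Q

/-- **Order bookkeeping: the stub says some `hcp ha hh` has `e_LJ(hcp ha hh) = e*`**, the periodic
infimum `ChargedEnergyGapNegative.eStar` (`eStar_le`: `e*` is a lower bound of the range; `le_ciInf`: a
lower bound is `≤ e*`). [folklore] -/
theorem stub_hcpPeriodicMinimum_iff_exists_eq_eStar :
    (∃ (a h : ℝ) (ha : a ≠ 0) (hh : h ≠ 0), ∀ Q : Literature.MathematicalPhysics.StatisticalMechanics.PeriodicConfiguration 3, (Literature.MathematicalPhysics.StatisticalMechanics.hcpPeriodicConfiguration ha hh).energyPerParticle Literature.MathematicalPhysics.StatisticalMechanics.lennardJones ≤ Q.energyPerParticle Literature.MathematicalPhysics.StatisticalMechanics.lennardJones) ↔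
      ∃ (a h : ℝ) (ha : a ≠ 0) (hh : h ≠ 0), (Literature.MathematicalPhysics.StatisticalMechanics.hcpPeriodicConfiguration ha hh).energyPerParticle Literature.MathematicalPhysics.StatisticalMechanics.lennardJones = eStar := by
  -- adapted from Theorems/ThreeConeCertificateExactCertificatePeriodicMinimum.lean
  -- (`periodicMinimum_iff_exists_eq_eStar`, anonymous minimiser)
  refine exists_congr fun a => exists_congr fun h => exists_congr fun ha => exists_congr fun hh => ?_
  refine ⟨fun hmin => le_antisymm (le_ciInf hmin) (eStar_le _), fun heq Q => ?_⟩
  rw [heq]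
  exact eStar_le Q

end Summit.AtomisticToContinuum.Crystallization.Theorems.BraggSlacknessRigidityStrictCertificate

end
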